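import Literature.NumberTheory.EllipticCurves.KatoTwistedFinitenessProofs
import Literature.NumberTheory.EllipticCurves.SelmerPInftyGaloisAction
import Literature.NumberTheory.EllipticCurves.MordellWeilTheoremProofs
import Literature.NumberTheory.EllipticCurves.PointDivisibilityProofs
import Mathlib.GroupTheory.FiniteAbelian.Basic
import HarnessLib

/-!
# Kato's Cor. 14.3 (2) from Thm. 14.2 (2): `χ`-part Kummer descent `Sel(K, T_pE)^(χ) ⇝ E(K)^(χ)`

K. Kato, *`p`-adic Hodge theory and values of zeta functions of modular forms*, Astérisque 295
(2004), proves the finiteness of `χ`-parts of SELMER groups (Thm. 14.2 (2), p. 235: for a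
newform `f` of even weight `k`, a finite abelian `K/ℚ`, a character `χ` of `Gal(K/ℚ)` with
`L(f, χ, k/2) ≠ 0`, and every `Gal(ℚ̄/ℚ)`-stable lattice `T` of `V_{F_λ}(f)(k/2)`, the `χ`-part
`Sel(K, T)^(χ)` is finite, where (14.1, p. 234) `Sel(K, T) ⊂ H¹(K, T ⊗ ℚ/ℤ)` is the Bloch–Kato
Selmer group) and DEDUCES the Mordell–Weil statement (Cor. 14.3 (2), p. 235: `A(K)^(χ)` is finite
for a quotient `A` of `J₁(N)` with `L(A, χ, 1) ≠ 0`) through "the usual Selmer group `Sel(K, A)`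
of `A` coincides with `⊕_p Sel(K, T_p(A))`" (p. 235) and the Kummer sequence. For `A = E` an
elliptic curve and `T = T_p E` one has `T ⊗ ℚ/ℤ = E[p^∞]` and `Sel(K, T_p E)` is the tree's
`Sel_{p^∞}(E/K) = selmerGroupPInfty (W.baseChange K) p ⊂ H¹(K, E[p^∞])`.

This file PROVES that deduction, `χ`-part by `χ`-part, in the vocabulary of the tree's named fact
`Literature.NumberTheory.EllipticCurves.kato_finite_chiPart_of_twistedLValue_ne_zero`
(`KatoTwistedFiniteness.lean`; Kato's `χ`-part `chiPart`, the action `σ ↦ Point.map σ` of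
`Aut(K/ℚ)` on `E(K)`), using the `Aut(K/ℚ)`-module structure of `H¹(K, E[p^∞])` of
`SelmerPInftyGaloisAction` (`IsLiftOfAut.conjH1Primary`, `[f] ↦ [g ↦ τ f(τ⁻¹ g τ)]` for a lift `τ`
of `σ`) and the `p^∞` Kummer theory of `SelmerCorankProofs` (`kummerMapPInfty`, its injectivity,
`range κ = ker (H¹(K, E[p^∞]) → H¹(K, E)) ⊆ Sel_{p^∞}(E/K)`):

* `IsLiftOfAut.conjH1Primary_kummerClass`, `conjH1Primary_kummerMapLevel`,
  `conjH1Primary_kummerMapPInfty` — **the `p^∞` Kummer map is `Aut(K/ℚ)`-equivariant**: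
  `σ_* κ(P ⊗ x) = κ(σP ⊗ x)` (the cocycle of `σ_* [g ↦ gQ - Q]` is `g ↦ g(τQ) - τQ`, and `τQ` is a
  `p^N`-th root of `σP`); the `p^∞` companion of the tree's `conjAct_kummerMapTorsion`
  (`HeegnerPointsKolyvaginPrimaryLeavesProofs`, level `n`).
* `kummerMapPInfty_tmul_mem_chiPart` — hence `κ` maps `E(K)^(χ) ⊗ ℚ_p/ℤ_p` into the `χ`-part of
  `H¹(K, E[p^∞])`, inside `Sel_{p^∞}(E/K)`.
* `IsLiftOfAut.conjH1Primary_eq`, `IsLiftOfAut.conjH1Primary_trans`, `conjH1Primary_one_refl`,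
  `IsLiftOfAut.conjH1Primary_eq_comp_of_mul`, `IsLiftOfAut.conjH1Primary_eq_id`,
  `IsLiftOfAut.conjH1Primary_inv_apply` — **`σ ↦ σ_*` is an action of `Aut(K/ℚ)` on
  `H¹(K, E[p^∞])`**: independence of the lift (two lifts differ by `γ ∈ Γ_K` and inner
  automorphisms act trivially on `H¹`, Serre, *Local Fields*, VII.§5, Prop. 3), multiplicativity
  and identity (Mathlib `ContinuousCohomology.map_comp/map_id`), verbatim the arguments of the
  tree's `conjH1_eq`, `conjH1_trans`, `conjH1_one_refl`, `conjAct_mul`, `conjAct_one` for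
  `H¹(K, E[n])` (`SelmerGaloisAction`); this is the `G = Gal(K/ℚ)`-module structure with respect
  to which Kato's `χ`-parts of `Sel(K, T_p E) ⊂ H¹(K, E[p^∞])` are taken (it preserves the finite
  Selmer conditions: the tree's `conjH1Primary_mem_finSelmerGroupPInfty`).
* `exists_tmul_prufGen_ne_zero` — in a finitely generated abelian group `M`, a point `P` of
  infinite order has `P ⊗ [p^{-L}] ≠ 0` in `M ⊗ ℚ_p/ℤ_p` for some `L` (a coordinate functional of
  the free quotient `M/M_tors` with `φ(P) ≠ 0`, and `a • [p^{-L}] ≠ 0` in `ℚ_p/ℤ_p` once `p^L ∤ a`).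
* `finite_chiPart_point_of_finite_chiPart_selmerGroupPInfty` (and `…_of_lifts`) — **Kato's
  deduction 14.2 (2) ⇒ 14.3 (2) for `T = T_p E`, any number field `K`, any `χ : Aut(K/ℚ) → R`**:
  if the `χ`-part of `Sel_{p^∞}(E/K)` is finite then `E(K)^(χ)` is finite. Proof: otherwise the
  finitely generated (Mordell–Weil, `module_finite_point_holds`) group `E(K)^(χ)` has a point `P`
  of infinite order (`Module.finite_of_fg_torsion`), and the classes `κ(P ⊗ [p^{-L-i}])`, `i ≥ 0`,
  are pairwise distinct elements of `Sel_{p^∞}(E/K)^(χ)` (injectivity of `κ`; a coincidence at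
  levels `n < n'` forces `P ⊗ [p^{-n'}] = 0`, hence `P ⊗ [p^{-L}] = 0`).
* `kato_finite_chiPart_of_twistedLValue_ne_zero_of_selmer` (and `…_of_lifts`),
  `kato_finite_chiPart_cyclotomic_of_twistedLValue_ne_zero_of_selmer` — consequently the named
  fact `kato_finite_chiPart_of_twistedLValue_ne_zero` (Cor. 14.3 (2) for `E/ℚ`, `K = ℚ(ζ_m)`,
  `m ≢ 2 (mod 4)`) and its all-moduli form (every `m`, the statement of
  `kato_finite_chiPart_cyclotomic_of_twistedLValue_ne_zero_of`, `KatoTwistedFinitenessProofs`)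
  follow from Kato's Thm. 14.2 (2) for `T = T_p E` at a single
  prime `p`, stated in the tree's vocabulary as the explicit hypothesis `hSel` (NOT proved here: it
  is Kato's Euler-system theorem proper, §§8–13 and 14.6–14.22 of the source).

No named fact is introduced; everything in this file is proved.

## References

* K. Kato, *`p`-adic Hodge theory and values of zeta functions of modular forms*, Astérisque 295
  (2004), 117–290: 14.1 (p. 234, `Sel(K, T) ⊂ H¹(K, T ⊗ ℚ/ℤ)`), Thm. 14.2 (2) and Cor. 14.3 (2)
  (p. 235, "`Sel(K, A)` coincides with `⊕_p Sel(K, T_p(A))`"). [Kato2004Asterisque]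
* R. Greenberg, *Iwasawa theory for elliptic curves*, LNM 1716 (1999), §2, pp. 62–63 (the Kummer
  sequence `0 → E(K) ⊗ ℚ_p/ℤ_p → Sel_{p^∞}(E/K)`). [Greenberg1999LNM]
* B. H. Gross, *Kolyvagin's work on modular elliptic curves*, LMS LNS 153 (1991), §5 (5.1) (the
  action of `Gal(K/ℚ)` on `H¹(K, E_p)` and its compatibility with the Kummer map). [GrossLMS1991]
* J.-P. Serre, *Local Fields*, GTM 67 (1979), VII.§5, Prop. 3 (inner automorphisms act trivially
  on cohomology). [SerreLocalFields1979]
* T. Dokchitser, V. Dokchitser, *On the Birch–Swinnerton-Dyer quotients modulo squares*, Ann. of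
  Math. 172 (2010), Lemma 4.14 (`Sel_{p^∞}(E/F)` as a `G`-module). [DokchitserDokchitserAnnals2010]
-/

noncomputable section

open scoped Classical TensorProduct

universe u

namespace Literature.NumberTheory.EllipticCurves

open WeierstrassCurve GaloisRepresentations

/-! ## `Aut(K/ℚ)`-equivariance of the `p^∞` Kummer map -/

section Equivariance

variable {K : Type u} [Field K] [CharZero K] (W : WeierstrassCurve ℚ) (p : ℕ) [hp : Fact p.Prime]
variable {σ : K ≃ₐ[ℚ] K} {τ : AlgebraicClosure K ≃+* AlgebraicClosure K}

/-- A lift `τ` of `σ` moves the image of `P ∈ E(K)` in `E(K̄)` to the image of `σ P` (the tree's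
`IsLiftOfAut.pointsMap_toGeomPoints` of `HeegnerPointsKolyvaginPrimaryLeavesProofs`, restated to
keep the import graph of this file small). [folklore] -/
theorem IsLiftOfAut.pointsMap_toGeomPoints' (hτ : IsLiftOfAut σ τ)
    (P : (W.baseChange K).toAffine.Point) :
    hτ.pointsMap W (toGeomPoints (W.baseChange K) P) =
      toGeomPoints (W.baseChange K) (Affine.Point.map (W' := W.toAffine) (σ : K →ₐ[ℚ] K) P) := by
  rcases P with _ | ⟨x, y, h⟩
  · rfl
  · exact Affine.Point.some_eq_some_of_eq (hτ x) (hτ y)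

omit hp in
/-- **`σ_*` of a `p^∞` Kummer class is the Kummer class of the moved root**:
`σ_* [g ↦ gQ - Q] = [g ↦ g(τQ) - τQ]` in `H¹(K, E[p^∞])` for a lift `τ` of `σ ∈ Aut(K/ℚ)` — the
cocycle of `σ_* = conjH1Primary` is `g ↦ τ((τ⁻¹gτ)Q - Q) = g(τQ) - τQ`. Gross 1991, §5 (the action
of `Gal(K/ℚ)` on (2.2)); the `p^∞` companion of the tree's `IsLiftOfAut.conjAct_kummerClassTorsion`.
[cite: GrossLMS1991, §5 (5.1)] -/
theorem IsLiftOfAut.conjH1Primary_kummerClass (hτ : IsLiftOfAut σ τ) (n : ℕ)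
    (Q : geomPoints (W.baseChange K))
    (hQ : ∀ g : Field.absoluteGaloisGroup K, g • (p ^ n • Q) = p ^ n • Q)
    (hQ' : ∀ g : Field.absoluteGaloisGroup K,
      g • (p ^ n • hτ.pointsMap W Q) = p ^ n • hτ.pointsMap W Q) :
    hτ.conjH1Primary W p (kummerClass (W.baseChange K) p n Q hQ) =
      kummerClass (W.baseChange K) p n (hτ.pointsMap W Q) hQ' := by
  unfold IsLiftOfAut.conjH1Primary resH1Hom kummerClass
  rw [LinearMap.toAddMonoidHom_coe, ContinuousLinearMap.coe_coe, map_oneCocycleClass]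
  congr 1
  apply Subtype.ext
  ext g : 1
  apply Subtype.ext
  rw [contOneCocycles.pullback_apply]
  change hτ.pointsMap W (hτ.conjGalCMH g • Q - Q) = g • hτ.pointsMap W Q - hτ.pointsMap W Q
  rw [map_sub, hτ.pointsMap_smul]

variable [(W.baseChange K).IsElliptic] (hdiv : (W.baseChange K).zsmul_geomPoints_surjective)

/-- **The level-`n` Kummer map commutes with `Aut(K/ℚ)`**: `σ_* κ_n(P) = κ_n(σ P)` for `P ∈ E(K)`
(`κ_n(P) = [g ↦ gQ - Q]` with `p^n Q = P`; `τQ` is a `p^n`-th root of `σP`).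
[cite: GrossLMS1991, §5 (5.1)] -/
theorem conjH1Primary_kummerMapLevel (hτ : IsLiftOfAut σ τ) (n : ℕ)
    (P : (W.baseChange K).toAffine.Point) :
    hτ.conjH1Primary W p (kummerMapLevel (W.baseChange K) p hdiv n P) =
      kummerMapLevel (W.baseChange K) p hdiv n
        (Affine.Point.map (W' := W.toAffine) (σ : K →ₐ[ℚ] K) P) := by
  have hR : p ^ n • hτ.pointsMap W (kummerRoot (W.baseChange K) p hdiv n P) =
      toGeomPoints (W.baseChange K) (Affine.Point.map (W' := W.toAffine) (σ : K →ₐ[ℚ] K) P) := by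
    rw [← map_nsmul, nsmul_kummerRoot, hτ.pointsMap_toGeomPoints']
  rw [kummerMapLevel_eq_kummerClass (W.baseChange K) p hdiv n _ _ hR]
  exact hτ.conjH1Primary_kummerClass W p n _ _ _

/-- **The `p^∞` Kummer map `κ : E(K) ⊗ ℚ_p/ℤ_p → H¹(K, E[p^∞])` is `Aut(K/ℚ)`-equivariant**:
`σ_* κ(P ⊗ x) = κ(σP ⊗ x)` (write `x = a • [p^{-N}]`, so `κ(P ⊗ x) = κ_N(a • P)`).
Gross 1991, §5 (5.1); Greenberg 1999, §2, p. 62. [cite: GrossLMS1991, §5 (5.1)] -/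
theorem conjH1Primary_kummerMapPInfty (hτ : IsLiftOfAut σ τ)
    (P : (W.baseChange K).toAffine.Point) (x : PruferQuot p) :
    hτ.conjH1Primary W p (kummerMapPInfty (W.baseChange K) p hdiv (P ⊗ₜ x)) =
      kummerMapPInfty (W.baseChange K) p hdiv
        (Affine.Point.map (W' := W.toAffine) (σ : K →ₐ[ℚ] K) P ⊗ₜ x) := by
  obtain ⟨N, a, rfl⟩ := exists_eq_zsmul_prufGen p x
  rw [← TensorProduct.smul_tmul, ← TensorProduct.smul_tmul, kummerMapPInfty_tmul_prufGen,
    kummerMapPInfty_tmul_prufGen, ← map_zsmul]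
  exact conjH1Primary_kummerMapLevel W p hdiv hτ N (a • P)

/-- **The Kummer map carries `E(K)^(χ)` into the `χ`-part of `H¹(K, E[p^∞])`**: for
`P ∈ E(K)^(χ)` (Kato's `χ`-part for `σ ↦ Point.map σ`) and `x ∈ ℚ_p/ℤ_p`, `κ(P ⊗ x)` is killed by
`I_χ` acting through `σ ↦ σ_* = conjH1Primary` (any lifts `τ σ`): for `∑ n_σ χ(σ) = 0`,
`∑ n_σ σ_* κ(P ⊗ x) = κ((∑ n_σ σP) ⊗ x) = κ(0) = 0`. Kato, Astérisque 295, p. 235 (the `χ`-parts of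
`A(K)` and of `Sel(K, ·)` are compared through the Kummer sequence).
[cite: Kato2004Asterisque, Cor. 14.3 (2) (p. 235)] -/
theorem kummerMapPInfty_tmul_mem_chiPart {R : Type*} [CommRing R]
    (τ : (K ≃ₐ[ℚ] K) → (AlgebraicClosure K ≃+* AlgebraicClosure K))
    (hτ : ∀ σ, IsLiftOfAut σ (τ σ)) (χ : (K ≃ₐ[ℚ] K) → R)
    {P : (W.baseChange K).toAffine.Point}
    (hP : P ∈ chiPart
      (fun σ : K ≃ₐ[ℚ] K => Affine.Point.map (W' := W.toAffine) (σ : K →ₐ[ℚ] K)) χ)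
    (x : PruferQuot p) :
    kummerMapPInfty (W.baseChange K) p hdiv (P ⊗ₜ x) ∈
      chiPart (fun σ : K ≃ₐ[ℚ] K => (hτ σ).conjH1Primary W p) χ := by
  intro a ha
  -- `ψ m = κ(m ⊗ x)` is additive in `m`
  let ψ : (W.baseChange K).toAffine.Point →+ galH1Primary (W.baseChange K) p :=
    (kummerMapPInfty (W.baseChange K) p hdiv).comp
      ((TensorProduct.mk ℤ (W.baseChange K).toAffine.Point (PruferQuot p)).flip x).toAddMonoidHom
  have hψapply : ∀ m, ψ m = kummerMapPInfty (W.baseChange K) p hdiv (m ⊗ₜ x) := fun m => rfl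
  have key := hP a ha
  calc (a.sum fun σ n => n • (hτ σ).conjH1Primary W p
          (kummerMapPInfty (W.baseChange K) p hdiv (P ⊗ₜ x)))
      = a.sum fun σ n => ψ (n • Affine.Point.map (W' := W.toAffine) (σ : K →ₐ[ℚ] K) P) := by
        refine Finsupp.sum_congr fun σ _ => ?_
        rw [map_zsmul, hψapply, conjH1Primary_kummerMapPInfty W p hdiv (hτ σ)]
    _ = ψ (a.sum fun σ n => n • Affine.Point.map (W' := W.toAffine) (σ : K →ₐ[ℚ] K) P) :=
        (map_finsuppSum ψ a _).symm
    _ = 0 := by rw [key, map_zero]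

end Equivariance

/-! ## `σ ↦ σ_*` is an action of `Aut(K/ℚ)` on `H¹(K, E[p^∞])` -/

section Action

variable {K : Type u} [Field K] [CharZero K] (W : WeierstrassCurve ℚ) (p : ℕ)
variable {σ σ₁ σ₂ : K ≃ₐ[ℚ] K} {τ τ₁ τ₂ : AlgebraicClosure K ≃+* AlgebraicClosure K}

local notation "Kbar" => AlgebraicClosure K

/-- Changing the lift by `γ = τ₂⁻¹ τ₁ ∈ Γ_K` twists the coefficient side of the pair on `E[p^∞]`:
`τ₁ P = τ₂ (γ P)` (the `p^∞` companion of the tree's `IsLiftOfAut.torsionMap_eq_comp`).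
[folklore] -/
theorem IsLiftOfAut.primaryTorsionMap_eq_comp (hτ₁ : IsLiftOfAut σ τ₁) (hτ₂ : IsLiftOfAut σ τ₂) :
    hτ₁.primaryTorsionMap W p = (hτ₂.primaryTorsionMap W p).comp
      (DistribSMul.toAddMonoidHom (geomPrimaryTorsion (W.baseChange K) p) (hτ₁.divGal hτ₂)) := by
  ext P
  change hτ₁.pointsMap W P =
    hτ₂.pointsMap W ((hτ₁.divGal hτ₂) • (P : geomPoints (W.baseChange K)))
  generalize (P : geomPoints (W.baseChange K)) = R
  change ((W.baseChange K).baseChange Kbar).toAffine.Point at R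
  rcases R with _ | ⟨x, y, h⟩
  · rfl
  · exact Affine.Point.some_eq_some_of_eq (τ₂.apply_symm_apply _).symm
      (τ₂.apply_symm_apply _).symm

/-- **Independence of the lift**: two lifts of `σ ∈ Aut(K/ℚ)` induce the same automorphism
`σ_*` of `H¹(K, E[p^∞])` (they differ by `γ ∈ Γ_K`, which twists the compatible pair by an inner
automorphism, and inner automorphisms act trivially on `H¹`; the `p^∞` companion of the tree's
`IsLiftOfAut.conjH1_eq` on `H¹(K, E[n])`). Serre, *Local Fields*, VII.§5, Prop. 3.
[cite: SerreLocalFields1979, VII.§5 Prop. 3] -/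
theorem IsLiftOfAut.conjH1Primary_eq (hτ₁ : IsLiftOfAut σ τ₁) (hτ₂ : IsLiftOfAut σ τ₂) :
    hτ₁.conjH1Primary W p = hτ₂.conjH1Primary W p := by
  unfold IsLiftOfAut.conjH1Primary resH1Hom
  rw [map_one_eq_of_conj_comp hτ₂.conjGalCMH (hτ₂.primaryTorsionMap W p)
    (hτ₂.primaryTorsionMap_smul W p) (hτ₁.divGal hτ₂) (hτ₁.primaryTorsionMap_smul W p)
    (hτ₁.conjGalCMH_eq_conj_comp hτ₂) (hτ₁.primaryTorsionMap_eq_comp W p hτ₂)]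

/-- The coefficient side of the pair of a composite lift is the composite, on `E[p^∞]`.
[folklore] -/
theorem IsLiftOfAut.primaryTorsionMap_trans (hτ₁ : IsLiftOfAut σ₁ τ₁) (hτ₂ : IsLiftOfAut σ₂ τ₂) :
    (hτ₁.trans hτ₂).primaryTorsionMap W p =
      (hτ₂.primaryTorsionMap W p).comp (hτ₁.primaryTorsionMap W p) := by
  ext P
  change (hτ₁.trans hτ₂).pointsMap W P = hτ₂.pointsMap W (hτ₁.pointsMap W P)
  generalize (P : geomPoints (W.baseChange K)) = R
  change ((W.baseChange K).baseChange Kbar).toAffine.Point at R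
  rcases R with _ | ⟨x, y, h⟩
  · rfl
  · rfl

/-- **Multiplicativity**: the lift `τ₂ ∘ τ₁` of `σ₂ σ₁` acts on `H¹(K, E[p^∞])` as the composite of
the actions (Mathlib `ContinuousCohomology.map_comp`; the `p^∞` companion of the tree's
`IsLiftOfAut.conjH1_trans`). [folklore] -/
theorem IsLiftOfAut.conjH1Primary_trans (hτ₁ : IsLiftOfAut σ₁ τ₁) (hτ₂ : IsLiftOfAut σ₂ τ₂) :
    (hτ₁.trans hτ₂).conjH1Primary W p =
      (hτ₂.conjH1Primary W p).comp (hτ₁.conjH1Primary W p) := by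
  unfold IsLiftOfAut.conjH1Primary resH1Hom
  rw [map_one_eq_comp_of_eq hτ₁.conjGalCMH (hτ₁.primaryTorsionMap W p)
    (hτ₁.primaryTorsionMap_smul W p) hτ₂.conjGalCMH (hτ₂.primaryTorsionMap W p)
    (hτ₂.primaryTorsionMap_smul W p) ((hτ₁.trans hτ₂).primaryTorsionMap_smul W p)
    (hτ₁.conjGalCMH_trans hτ₂) (hτ₁.primaryTorsionMap_trans W p hτ₂)]
  rfl

/-- **Identity**: the trivial lift acts trivially on `H¹(K, E[p^∞])` (Mathlib
`ContinuousCohomology.map_id`; the `p^∞` companion of the tree's `conjH1_one_refl`). [folklore] -/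
theorem conjH1Primary_one_refl :
    (isLiftOfAut_one_refl (k := ℚ) (K := K)).conjH1Primary W p = AddMonoidHom.id _ := by
  unfold IsLiftOfAut.conjH1Primary resH1Hom
  rw [map_one_eq_id_of_eq]
  · rfl
  · apply ContinuousMonoidHom.ext
    intro g
    apply AlgEquiv.ext
    intro x
    rfl
  · ext P
    change (isLiftOfAut_one_refl (k := ℚ) (K := K)).pointsMap W P = P
    generalize (P : geomPoints (W.baseChange K)) = R
    change ((W.baseChange K).baseChange Kbar).toAffine.Point at R
    rcases R with _ | ⟨x, y, h⟩
    · rfl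
    · rfl

/-- **`Aut(K/ℚ)` acts on `H¹(K, E[p^∞])`: multiplicativity for arbitrary lifts.** If `τ₁`, `τ₂`,
`τ` lift `σ₁`, `σ₂`, `σ₂ σ₁` then `(σ₂ σ₁)_* = σ₂_* ∘ σ₁_*` (`τ` and `τ₂ ∘ τ₁` both lift `σ₂ σ₁`,
`IsLiftOfAut.conjH1Primary_eq`, `IsLiftOfAut.conjH1Primary_trans`). With
`conjH1Primary_eq_id_of_isLiftOfAut_one` this makes `H¹(K, E[p^∞])` a `ℤ[G]`-module for
`G = Aut(K/ℚ)` through `σ ↦ σ_*` — the `G = Gal(K/ℚ)`-module structure on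
`H¹(K, E[p^∞]) ⊇ Sel(K, T_p E)` with respect to which Kato's `χ`-parts
`Sel(K, T)^(χ) = {x ; I_χ · x = 0}` are taken (Astérisque 295, Thm. 14.2 (2), p. 235); the `p^∞`
companion of the tree's `conjAct_mul` on `H¹(K, E[n])`; Gross 1991, §5 (5.1); Dokchitser–Dokchitser
2010, Lemma 4.14 (`Sel_{p^∞}(E/F)` as a `G`-module). [cite: GrossLMS1991, §5 (5.1)] -/
theorem IsLiftOfAut.conjH1Primary_eq_comp_of_mul (hτ₁ : IsLiftOfAut σ₁ τ₁) (hτ₂ : IsLiftOfAut σ₂ τ₂)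
    (hτ : IsLiftOfAut (σ₂ * σ₁) τ) :
    hτ.conjH1Primary W p = (hτ₂.conjH1Primary W p).comp (hτ₁.conjH1Primary W p) := by
  rw [hτ.conjH1Primary_eq W p (hτ₁.trans hτ₂), IsLiftOfAut.conjH1Primary_trans]

/-- **Identity**: any lift of `σ = 1 ∈ Aut(K/ℚ)` (an element of `Γ_K`) acts trivially on
`H¹(K, E[p^∞])` (the `p^∞` companion of the tree's `conjAct_one`). [folklore] -/
theorem IsLiftOfAut.conjH1Primary_eq_id (hτ : IsLiftOfAut σ τ) (hσ : σ = 1) :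
    hτ.conjH1Primary W p = AddMonoidHom.id _ := by
  subst hσ
  rw [hτ.conjH1Primary_eq W p isLiftOfAut_one_refl, conjH1Primary_one_refl]

/-- **Identity**: any lift of `1 ∈ Aut(K/ℚ)` acts trivially on `H¹(K, E[p^∞])`. [folklore] -/
theorem conjH1Primary_eq_id_of_isLiftOfAut_one (hτ : IsLiftOfAut (1 : K ≃ₐ[ℚ] K) τ) :
    hτ.conjH1Primary W p = AddMonoidHom.id _ :=
  hτ.conjH1Primary_eq_id W p rfl

/-- With the tree's chosen lifts `liftAut σ` (`isLiftOfAut_liftAut`):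
`(σ₂ σ₁)_* = σ₂_* ∘ σ₁_*` on `H¹(K, E[p^∞])`. [folklore] -/
theorem conjH1Primary_liftAut_mul (σ₁ σ₂ : K ≃ₐ[ℚ] K) :
    (isLiftOfAut_liftAut (σ₂ * σ₁)).conjH1Primary W p =
      ((isLiftOfAut_liftAut σ₂).conjH1Primary W p).comp
        ((isLiftOfAut_liftAut σ₁).conjH1Primary W p) :=
  IsLiftOfAut.conjH1Primary_eq_comp_of_mul W p _ _ _

/-- With the tree's chosen lift: `1_* = id` on `H¹(K, E[p^∞])`. [folklore] -/
theorem conjH1Primary_liftAut_one :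
    (isLiftOfAut_liftAut (1 : K ≃ₐ[ℚ] K)).conjH1Primary W p = AddMonoidHom.id _ :=
  conjH1Primary_eq_id_of_isLiftOfAut_one W p _

/-- `σ_*` is invertible: `(σ⁻¹)_* ∘ σ_* = id` (any lifts). [folklore] -/
theorem IsLiftOfAut.conjH1Primary_inv_apply (hτ : IsLiftOfAut σ τ) {τ' : Kbar ≃+* Kbar}
    (hτ' : IsLiftOfAut σ⁻¹ τ') (x : galH1Primary (W.baseChange K) p) :
    hτ'.conjH1Primary W p (hτ.conjH1Primary W p x) = x := by
  rw [← AddMonoidHom.comp_apply,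
    ← IsLiftOfAut.conjH1Primary_eq_comp_of_mul W p hτ hτ' (hτ.trans hτ'),
    (hτ.trans hτ').conjH1Primary_eq_id W p (inv_mul_cancel σ), AddMonoidHom.id_apply]

end Action

/-! ## Points of infinite order survive in `M ⊗ ℚ_p/ℤ_p` -/

section InfiniteOrder

variable (p : ℕ) [hp : Fact p.Prime]

/-- `a • [p^{-L}] ≠ 0` in `ℚ_p/ℤ_p` for `L = |a|`, `a ≠ 0` (`a/p^L ∈ ℤ_p` would force `p^L ∣ a`,
`Padic.pow_dvd_of_int_div_pow_mem`, but `p^{|a|} > |a|`). [folklore] -/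
theorem zsmul_prufGen_natAbs_ne_zero {a : ℤ} (ha : a ≠ 0) : a • prufGen p a.natAbs ≠ 0 := by
  intro h
  have hmk : (((a : ℚ_[p]) / (p : ℚ_[p]) ^ a.natAbs + ((0 : ℤ_[p]) : ℚ_[p]) : ℚ_[p]) :
      ℚ_[p] ⧸ (PadicInt.subring p).toAddSubgroup) = a • prufGen p a.natAbs := by
    rw [PruferQuot.mk_int_div_pow_add]
    rfl
  rw [h, PadicInt.coe_zero, add_zero, QuotientAddGroup.eq_zero_iff] at hmk
  have hdvd : (p ^ a.natAbs : ℤ) ∣ a := Padic.pow_dvd_of_int_div_pow_mem p a.natAbs a hmk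
  have h1 : (p : ℤ) ^ a.natAbs ≤ (a.natAbs : ℤ) :=
    Int.le_of_dvd (by exact_mod_cast Int.natAbs_pos.mpr ha) (Int.dvd_natAbs.mpr hdvd)
  have hle : p ^ a.natAbs ≤ a.natAbs := by exact_mod_cast h1
  exact absurd hle (not_le.mpr (Nat.lt_pow_self hp.out.one_lt))

variable {M : Type*} [AddCommGroup M]

/-- **A point of infinite order survives in `M ⊗ ℚ_p/ℤ_p`.** In a finitely generated abelian group
`M`, if `a • P ≠ 0` for every integer `a ≠ 0` then `P ⊗ [p^{-L}] ≠ 0` for some `L`: the quotient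
`M/M_tors` is free of finite rank, some coordinate functional `φ : M → ℤ` has `φ(P) ≠ 0`, and
`(φ ⊗ 1)(P ⊗ [p^{-L}]) = φ(P) • [p^{-L}] ≠ 0` for `L = |φ(P)|`. Greenberg 1999, §2, p. 62
(`E(K) ⊗ ℚ_p/ℤ_p ≅ (ℚ_p/ℤ_p)^{rank E(K)}`). [folklore] -/
theorem exists_tmul_prufGen_ne_zero [Module.Finite ℤ M] {P : M}
    (hP : ∀ a : ℤ, a ≠ 0 → a • P ≠ 0) :
    ∃ L : ℕ, P ⊗ₜ[ℤ] prufGen p L ≠ (0 : M ⊗[ℤ] PruferQuot p) := by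
  have hPT : (Submodule.torsion ℤ M).mkQ P ≠ 0 := by
    intro h0
    rw [Submodule.mkQ_apply, Submodule.Quotient.mk_eq_zero, Submodule.mem_torsion_iff] at h0
    obtain ⟨a, ha⟩ := h0
    exact hP a (nonZeroDivisors.ne_zero a.2) ha
  haveI : Module.IsTorsionFree ℤ (M ⧸ Submodule.torsion ℤ M) :=
    Submodule.QuotientTorsion.instIsTorsionFree
  haveI : Module.Finite ℤ (M ⧸ Submodule.torsion ℤ M) := Module.Finite.quotient ℤ _
  haveI : Module.Free ℤ (M ⧸ Submodule.torsion ℤ M) := Module.free_of_finite_type_torsion_free'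
  let b := Module.Free.chooseBasis ℤ (M ⧸ Submodule.torsion ℤ M)
  have hrepr : b.repr ((Submodule.torsion ℤ M).mkQ P) ≠ 0 := fun h0 =>
    hPT (b.repr.injective (by rw [h0, map_zero]))
  obtain ⟨i, hi⟩ : ∃ i, b.repr ((Submodule.torsion ℤ M).mkQ P) i ≠ 0 := by
    by_contra h
    push Not at h
    exact hrepr (Finsupp.ext h)
  let φ : M →ₗ[ℤ] ℤ := (b.coord i).comp (Submodule.torsion ℤ M).mkQ
  have hφP : φ P ≠ 0 := hi
  refine ⟨(φ P).natAbs, fun h0 => zsmul_prufGen_natAbs_ne_zero p hφP ?_⟩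
  have h1 := congrArg (fun t => TensorProduct.lid ℤ (PruferQuot p) (φ.rTensor (PruferQuot p) t)) h0
  simpa only [LinearMap.rTensor_tmul, TensorProduct.lid_tmul, map_zero] using h1

/-- If `P ⊗ [p^{-n}] = P ⊗ [p^{-n'}]` with `n < n'` then `P ⊗ [p^{-l}] = 0` for all `l ≤ n'`:
`t = P ⊗ [p^{-n'}]` satisfies `t = p^k t` (`k = n' - n ≥ 1`), hence `t = p^{mk} t` for all `m`, and
`p^{n'} t = P ⊗ (p^{n'} [p^{-n'}]) = 0`. [folklore] -/
theorem tmul_prufGen_eq_zero_of_eq {P : M} {n n' : ℕ} (hlt : n < n')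
    (heq : P ⊗ₜ[ℤ] prufGen p n = P ⊗ₜ[ℤ] prufGen p n') {l : ℕ} (hl : l ≤ n') :
    P ⊗ₜ[ℤ] prufGen p l = (0 : M ⊗[ℤ] PruferQuot p) := by
  obtain ⟨k, rfl⟩ := Nat.exists_eq_add_of_lt hlt
  -- `t = P ⊗ e_{n+k+1}` satisfies `t = p^(k+1) • t`
  have hgen : ((p ^ (k + 1) : ℕ) : ℤ) • prufGen p (n + k + 1) = prufGen p n := by
    rw [add_assoc]
    exact zsmul_prufGen_add p n (k + 1)
  have hfix : ((p ^ (k + 1) : ℕ) : ℤ) • (P ⊗ₜ[ℤ] prufGen p (n + k + 1)) =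
      P ⊗ₜ[ℤ] prufGen p (n + k + 1) := by
    rw [← TensorProduct.tmul_smul, hgen, heq]
  -- hence `t = p^(m(k+1)) • t` for every `m`
  have hiter : ∀ m : ℕ, ((p ^ (m * (k + 1)) : ℕ) : ℤ) • (P ⊗ₜ[ℤ] prufGen p (n + k + 1)) =
      P ⊗ₜ[ℤ] prufGen p (n + k + 1) := by
    intro m
    induction m with
    | zero => simp
    | succ m ih => rw [add_mul, one_mul, pow_add, Nat.cast_mul, ← smul_smul, hfix, ih]
  -- and `p^(n+k+1) • t = 0`
  have hkill : ((p ^ (n + k + 1) : ℕ) : ℤ) • (P ⊗ₜ[ℤ] prufGen p (n + k + 1)) = 0 := by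
    rw [← TensorProduct.tmul_smul, zsmul_prufGen_self, TensorProduct.tmul_zero]
  have ht0 : P ⊗ₜ[ℤ] prufGen p (n + k + 1) = (0 : M ⊗[ℤ] PruferQuot p) := by
    have hle : n + k + 1 ≤ (n + k + 1) * (k + 1) := Nat.le_mul_of_pos_right _ (Nat.succ_pos k)
    obtain ⟨d, hd⟩ := Nat.exists_eq_add_of_le hle
    rw [← hiter (n + k + 1), hd, pow_add, Nat.cast_mul, mul_comm, ← smul_smul, hkill, smul_zero]
  -- finally `P ⊗ e_l = p^(n+k+1-l) • t = 0`
  obtain ⟨e, he⟩ := Nat.exists_eq_add_of_le hl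
  rw [← zsmul_prufGen_add p l e, TensorProduct.tmul_smul, ← he, ht0, smul_zero]

end InfiniteOrder

/-! ## Kato's deduction: `Sel_{p^∞}(E/K)^(χ)` finite ⇒ `E(K)^(χ)` finite -/

section Descent

variable {K : Type u} [Field K] [NumberField K] (W : WeierstrassCurve ℚ) [W.IsElliptic]
  (p : ℕ) [hp : Fact p.Prime]

/-- **Kato, Astérisque 295, Cor. 14.3 (2) from Thm. 14.2 (2), for `T = T_p E` — proved** (form
with arbitrary lifts `τ σ` of the `σ ∈ Aut(K/ℚ)`; see
`finite_chiPart_point_of_finite_chiPart_selmerGroupPInfty` for the lift-free form and the full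
statement). [cite: Kato2004Asterisque, Cor. 14.3 (2) (p. 235)] -/
theorem finite_chiPart_point_of_finite_chiPart_selmerGroupPInfty_of_lifts {R : Type*} [CommRing R]
    (τ : (K ≃ₐ[ℚ] K) → (AlgebraicClosure K ≃+* AlgebraicClosure K))
    (hτ : ∀ σ, IsLiftOfAut σ (τ σ)) (χ : (K ≃ₐ[ℚ] K) → R)
    (hSel : Finite ↥(chiPart (fun σ : K ≃ₐ[ℚ] K => (hτ σ).conjH1Primary W p) χ ⊓
      selmerGroupPInfty (W.baseChange K) p)) :
    Finite ↥(chiPart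
      (fun σ : K ≃ₐ[ℚ] K => Affine.Point.map (W' := W.toAffine) (σ : K →ₐ[ℚ] K)) χ) := by
  haveI : (W.baseChange K).IsElliptic := by rw [WeierstrassCurve.baseChange]; infer_instance
  have hdiv : (W.baseChange K).zsmul_geomPoints_surjective :=
    (W.baseChange K).zsmul_geomPoints_surjective_holds
  haveI : Module.Finite ℤ (W.baseChange K).toAffine.Point := (W.baseChange K).module_finite_point_holds
  by_contra hinf
  -- (1) a point of infinite order in `E(K)^(χ)`
  obtain ⟨P, hPA, hP⟩ : ∃ P ∈ chiPart
      (fun σ : K ≃ₐ[ℚ] K => Affine.Point.map (W' := W.toAffine) (σ : K →ₐ[ℚ] K)) χ,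
      ∀ a : ℤ, a ≠ 0 → a • P ≠ 0 := by
    by_contra h
    push Not at h
    let A : Submodule ℤ (W.baseChange K).toAffine.Point :=
      (chiPart (fun σ : K ≃ₐ[ℚ] K =>
        Affine.Point.map (W' := W.toAffine) (σ : K →ₐ[ℚ] K)) χ).toIntSubmodule
    haveI : Module.Finite ℤ A := Module.Finite.of_fg (IsNoetherian.noetherian A)
    have htors : Module.IsTorsion ℤ A := by
      intro x
      obtain ⟨a, ha, hax⟩ := h x x.2
      exact ⟨⟨a, mem_nonZeroDivisors_of_ne_zero ha⟩, Subtype.ext hax⟩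
    haveI : Finite A := Module.finite_of_fg_torsion A htors
    exact hinf (Finite.of_injective (fun x => (⟨x.1, x.2⟩ : A))
      fun x y hxy => Subtype.ext (congrArg Subtype.val hxy))
  -- (2) a level `L` at which `P` survives in `E(K) ⊗ ℚ_p/ℤ_p`
  obtain ⟨L, hL⟩ := exists_tmul_prufGen_ne_zero p hP
  -- (3) the Kummer classes `κ(P ⊗ e_{L+i})` lie in `Sel_{p^∞}(E/K)^(χ)`
  have hmem : ∀ i : ℕ, kummerMapPInfty (W.baseChange K) p hdiv (P ⊗ₜ prufGen p (L + i)) ∈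
      chiPart (fun σ : K ≃ₐ[ℚ] K => (hτ σ).conjH1Primary W p) χ ⊓
        selmerGroupPInfty (W.baseChange K) p := fun i =>
    ⟨kummerMapPInfty_tmul_mem_chiPart W p hdiv τ hτ χ hPA _,
      (W.baseChange K).ker_primaryH1ToH1_le_selmerGroupPInfty p
        (((W.baseChange K).range_kummerMapPInfty p hdiv).le ⟨_, rfl⟩)⟩
  haveI := hSel
  -- (4) two of them coincide, so `P ⊗ e_L = 0`: contradiction
  obtain ⟨i, j, hij, hc⟩ := Finite.exists_ne_map_eq_of_infinite
    (fun i : ℕ => (⟨kummerMapPInfty (W.baseChange K) p hdiv (P ⊗ₜ prufGen p (L + i)), hmem i⟩ :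
      ↥(chiPart (fun σ : K ≃ₐ[ℚ] K => (hτ σ).conjH1Primary W p) χ ⊓
        selmerGroupPInfty (W.baseChange K) p)))
  have heq : P ⊗ₜ[ℤ] prufGen p (L + i) = P ⊗ₜ[ℤ] prufGen p (L + j) :=
    (W.baseChange K).kummerMapPInfty_injective p hdiv (congrArg Subtype.val hc)
  rcases Nat.lt_or_gt_of_ne hij with h | h
  · exact hL (tmul_prufGen_eq_zero_of_eq p (Nat.add_lt_add_left h L) heq (Nat.le_add_right L j))
  · exact hL (tmul_prufGen_eq_zero_of_eq p (Nat.add_lt_add_left h L) heq.symm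
      (Nat.le_add_right L i))

/-- **Kato, Astérisque 295, Cor. 14.3 (2) from Thm. 14.2 (2), for `T = T_p E` — proved.** Let
`E = W/ℚ` be an elliptic curve, `K` a number field, `p` a prime, and `χ : Aut(K/ℚ) → R` any
function into a commutative ring (a character of `Gal(K/ℚ)` in the source). If the `χ`-part of the
Selmer group `Sel(K, T_p E) = Sel_{p^∞}(E/K) ⊂ H¹(K, E[p^∞])` (14.1, p. 234), for the action
`σ ↦ σ_*` of `Aut(K/ℚ)` on `H¹(K, E[p^∞])` (`IsLiftOfAut.conjH1Primary` of the chosen lifts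
`liftAut σ`; any lifts give the same maps, `IsLiftOfAut.conjH1Primary_eq`, and a general family of
lifts is allowed in `…_of_lifts`), is finite — the conclusion of
Thm. 14.2 (2) for this `T` — then Kato's `χ`-part `E(K)^(χ) = {x ∈ E(K) ; I_χ · x = 0}` of the
Mordell–Weil group (action `σ ↦ Point.map σ`) is finite — the conclusion of Cor. 14.3 (2) for
`A = E`. As printed (p. 235): "If `A` is an abelian variety over `K`, the usual Selmer group
`Sel(K, A)` of `A` coincides with `⊕_p Sel(K, T_p(A))` […] Corollary 14.3. […] (2) The `χ`-part
of `A(K)^(χ)` is finite." Proof (the Kummer sequence, Greenberg 1999, §2): `E(K)^(χ)` is finitely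
generated (Mordell–Weil); were it infinite it would contain a point `P` of infinite order,
`P ⊗ [p^{-L}] ≠ 0` in `E(K) ⊗ ℚ_p/ℤ_p` for some `L` (`exists_tmul_prufGen_ne_zero`), and the
Kummer classes `κ(P ⊗ [p^{-L-i}])`, `i ≥ 0`, would be infinitely many distinct
(`kummerMapPInfty_injective`, `tmul_prufGen_eq_zero_of_eq`) elements of `Sel_{p^∞}(E/K)`
(`range κ = ker (H¹(K, E[p^∞]) → H¹(K, E)) ⊆ Sel_{p^∞}`) lying in the `χ`-part
(`kummerMapPInfty_tmul_mem_chiPart`, equivariance of `κ`).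
[cite: Kato2004Asterisque, Cor. 14.3 (2) (p. 235)] -/
theorem finite_chiPart_point_of_finite_chiPart_selmerGroupPInfty {R : Type*} [CommRing R]
    (χ : (K ≃ₐ[ℚ] K) → R)
    (hSel : Finite ↥(chiPart (fun σ : K ≃ₐ[ℚ] K => (isLiftOfAut_liftAut σ).conjH1Primary W p) χ ⊓
      selmerGroupPInfty (W.baseChange K) p)) :
    Finite ↥(chiPart
      (fun σ : K ≃ₐ[ℚ] K => Affine.Point.map (W' := W.toAffine) (σ : K →ₐ[ℚ] K)) χ) :=
  finite_chiPart_point_of_finite_chiPart_selmerGroupPInfty_of_lifts W p (fun σ => liftAut σ)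
    (fun σ => isLiftOfAut_liftAut σ) χ hSel

end Descent

/-! ## The named fact from Kato's Thm. 14.2 (2) for `T = T_p E` -/

section NamedFact

open ModularForms CongruenceSubgroup

set_option backward.isDefEq.respectTransparency false in
/-- **`kato_finite_chiPart_of_twistedLValue_ne_zero` follows from Kato's Thm. 14.2 (2) for
`T = T_p E`.** The named fact of `KatoTwistedFiniteness` (Kato, Astérisque 295, Cor. 14.3 (2) for
`A = E/ℚ` elliptic with newform `f`, `K = ℚ(ζ_m)`, `m ≢ 2 (mod 4)`, `χ` a Dirichlet character mod
`m` read on `Gal(K/ℚ)`: `L(f, χ, 1) ≠ 0 ⇒ E(K)^(χ)` finite) is implied by the hypothesis `hSel`,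
which is Thm. 14.2 (2) (p. 235) for the lattice `T = T_p E` of `V_p(f)(1)` at ONE prime `p`, in the
tree's vocabulary: under the same hypotheses, for some prime `p`, the `χ`-part of
`Sel(K, T_p E) = Sel_{p^∞}(E/K)` for the action `σ ↦ σ_*` of `Gal(K/ℚ)` on `H¹(K, E[p^∞])`
(`IsLiftOfAut.conjH1Primary` of the chosen lifts `liftAut σ`; lift-independent,
`IsLiftOfAut.conjH1Primary_eq`) is finite ("the `χ`-part `Sel(K, T)^(χ)` of `Sel(K, T)` is finite"). The deduction
is `finite_chiPart_point_of_finite_chiPart_selmerGroupPInfty`; `hSel` itself (Kato's Euler-system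
argument, §§8–13, 14.6–14.22) is NOT proved in the tree. (The option
`backward.isDefEq.respectTransparency false` identifies the two `ℚ`-algebra structures on
`CyclotomicField m ℚ`, as in `KatoTwistedFiniteness`.)
[cite: Kato2004Asterisque, Thm. 14.2 (2) and Cor. 14.3 (2) (p. 235)] -/
theorem kato_finite_chiPart_of_twistedLValue_ne_zero_of_selmer
    (hSel : ∀ (W : WeierstrassCurve ℚ) [W.IsElliptic] {N : ℕ} [NeZero N]
      {f : CuspForm (Gamma0 N) 2} (_hf : IsNewformOf W f) {m : ℕ} [NeZero m] (_hm : m % 4 ≠ 2)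
      (χ : DirichletCharacter ℂ m)
      (_hL : ∃ L : ℂ → ℂ, Differentiable ℂ L ∧
        (∀ s : ℂ, 2 < s.re → L s = twistedLSeries f χ s) ∧ L 1 ≠ 0),
      ∃ (p : ℕ) (_ : Fact p.Prime),
        Finite ↥(chiPart (fun σ : CyclotomicField m ℚ ≃ₐ[ℚ] CyclotomicField m ℚ =>
              (isLiftOfAut_liftAut σ).conjH1Primary W p)
            (fun σ => (cyclotomicCharacterOf χ σ : ℂ)) ⊓
          selmerGroupPInfty (W.baseChange (CyclotomicField m ℚ)) p)) :
    kato_finite_chiPart_of_twistedLValue_ne_zero := by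
  intro W _ N _ f hf m _ hm χ hL
  obtain ⟨p, hp, hfin⟩ := hSel W hf hm χ hL
  haveI := hp
  exact finite_chiPart_point_of_finite_chiPart_selmerGroupPInfty W p
    (fun σ => (cyclotomicCharacterOf χ σ : ℂ)) hfin

set_option backward.isDefEq.respectTransparency false in
/-- The same from Thm. 14.2 (2) stated with arbitrary lifts `τ σ` of the `σ ∈ Gal(ℚ(ζ_m)/ℚ)`
(any lifts induce the same maps, `IsLiftOfAut.conjH1Primary_eq`).
[cite: Kato2004Asterisque, Thm. 14.2 (2) and Cor. 14.3 (2) (p. 235)] -/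
theorem kato_finite_chiPart_of_twistedLValue_ne_zero_of_selmer_of_lifts
    (hSel : ∀ (W : WeierstrassCurve ℚ) [W.IsElliptic] {N : ℕ} [NeZero N]
      {f : CuspForm (Gamma0 N) 2} (_hf : IsNewformOf W f) {m : ℕ} [NeZero m] (_hm : m % 4 ≠ 2)
      (χ : DirichletCharacter ℂ m)
      (_hL : ∃ L : ℂ → ℂ, Differentiable ℂ L ∧
        (∀ s : ℂ, 2 < s.re → L s = twistedLSeries f χ s) ∧ L 1 ≠ 0),
      ∃ (p : ℕ) (_ : Fact p.Prime)
        (τ : (CyclotomicField m ℚ ≃ₐ[ℚ] CyclotomicField m ℚ) →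
          (AlgebraicClosure (CyclotomicField m ℚ) ≃+* AlgebraicClosure (CyclotomicField m ℚ)))
        (hτ : ∀ σ, IsLiftOfAut σ (τ σ)),
        Finite ↥(chiPart (fun σ => (hτ σ).conjH1Primary W p)
            (fun σ => (cyclotomicCharacterOf χ σ : ℂ)) ⊓
          selmerGroupPInfty (W.baseChange (CyclotomicField m ℚ)) p)) :
    kato_finite_chiPart_of_twistedLValue_ne_zero := by
  intro W _ N _ f hf m _ hm χ hL
  obtain ⟨p, hp, τ, hτ, hfin⟩ := hSel W hf hm χ hL
  haveI := hp
  exact finite_chiPart_point_of_finite_chiPart_selmerGroupPInfty_of_lifts W p τ hτ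
    (fun σ => (cyclotomicCharacterOf χ σ : ℂ)) hfin

set_option backward.isDefEq.respectTransparency false in
/-- **The all-moduli form follows as well**: Kato's Thm. 14.2 (2) for `T = T_p E` over `ℚ(ζ_m)`,
`m ≢ 2 (mod 4)` (hypothesis `hSel`, as in `kato_finite_chiPart_of_twistedLValue_ne_zero_of_selmer`)
implies Cor. 14.3 (2) over `ℚ(ζ_m)` for EVERY `m ≥ 1` (mod-`m` series, any decidability instance
on `ℚ(ζ_m)`), through `kato_finite_chiPart_cyclotomic_of_twistedLValue_ne_zero_of`
(`KatoTwistedFinitenessProofs`: the case `m ≡ 2 (mod 4)` reduces to `m/2`).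
[cite: Kato2004Asterisque, Thm. 14.2 (2) and Cor. 14.3 (2) (p. 235)] -/
theorem kato_finite_chiPart_cyclotomic_of_twistedLValue_ne_zero_of_selmer
    (hSel : ∀ (W : WeierstrassCurve ℚ) [W.IsElliptic] {N : ℕ} [NeZero N]
      {f : CuspForm (Gamma0 N) 2} (_hf : IsNewformOf W f) {m : ℕ} [NeZero m] (_hm : m % 4 ≠ 2)
      (χ : DirichletCharacter ℂ m)
      (_hL : ∃ L : ℂ → ℂ, Differentiable ℂ L ∧
        (∀ s : ℂ, 2 < s.re → L s = twistedLSeries f χ s) ∧ L 1 ≠ 0),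
      ∃ (p : ℕ) (_ : Fact p.Prime),
        Finite ↥(chiPart (fun σ : CyclotomicField m ℚ ≃ₐ[ℚ] CyclotomicField m ℚ =>
              (isLiftOfAut_liftAut σ).conjH1Primary W p)
            (fun σ => (cyclotomicCharacterOf χ σ : ℂ)) ⊓
          selmerGroupPInfty (W.baseChange (CyclotomicField m ℚ)) p))
    (W : WeierstrassCurve ℚ) [W.IsElliptic] {N : ℕ} [NeZero N] {f : CuspForm (Gamma0 N) 2}
    (hf : IsNewformOf W f) {m : ℕ} [NeZero m] [DecidableEq (CyclotomicField m ℚ)]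
    (χ : DirichletCharacter ℂ m)
    (hL : ∃ L : ℂ → ℂ, Differentiable ℂ L ∧
      (∀ s : ℂ, 2 < s.re → L s = twistedLSeries f χ s) ∧ L 1 ≠ 0) :
    Finite (chiPart
      (fun σ : CyclotomicField m ℚ ≃ₐ[ℚ] CyclotomicField m ℚ =>
        Affine.Point.map (W' := W.toAffine) (σ : CyclotomicField m ℚ →ₐ[ℚ] CyclotomicField m ℚ))
      (fun σ => (cyclotomicCharacterOf χ σ : ℂ))) :=
  kato_finite_chiPart_cyclotomic_of_twistedLValue_ne_zero_of
    (kato_finite_chiPart_of_twistedLValue_ne_zero_of_selmer hSel) W hf χ hL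

end NamedFact

end Literature.NumberTheory.EllipticCurves

end
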